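import Mathlib.RingTheory.Ideal.Quotient.Operations
import Mathlib.LinearAlgebra.Quotient.Basic
import Mathlib.Algebra.Regular.SMul
import HarnessLib

/-!
# [OURS · L1 W4.5(b) · LINE (T-j)-PROOF support, ring core of (α)] The ideal of an `O`-flat closed subscheme meets the special
# fibre transversally: `I ∩ ϖA = ϖI`, and `I/ϖI → A/ϖA` is injective

Cell res-hironaka, LADDER-RESOLUTION rung L, slot W4.5(b), crux chain w45b: EL♮(3) = stmt-ResolutionOfSingularities-20148, residue (T-j) = F-102
(LINE (T-j)-PROOF brick B4, sub-lemma (α) of res-D-pv-035: `(pullback i).obj (idealModule s_j) ≅ idealModule (z_j ↪ C_k)` — on an affine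
chart `Spec A` of `C` with `C_k = Spec A/ϖA` this says `Γ(i^*𝓘) = I/ϖI = (A/ϖ) ⊗_A I → A/ϖA` is INJECTIVE with image `I·(A/ϖA)`, which holds
exactly when `A/I` (the section `D_j ≅ Spec O`) has no `ϖ`-torsion; the tensor spelling follows with Mathlib
`TensorProduct.quotTensorEquivQuotSMul : (A ⧸ J) ⊗[A] M ≃ₗ M ⧸ J • M`). res-L1-w45b-plan-1 DESK WORD 2026-08-27T22:12:47Z «036 → the RING
CORE of (α)»; seat res-D-pv-036 g11 (on-call supplier). `--supports stmt-ResolutionOfSingularities-20148 --as helper`. NOT a statement of any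
manuscript; OURS; AI-written, weaker than expert review. Definition-free; Mathlib-only; standard axioms.

For a commutative ring `A`, an ideal `I`, and `ϖ ∈ A` such that `A/I` has NO `ϖ`-TORSION (`∀ a, ϖa ∈ I → a ∈ I`; `torsionFree_of_isSMulRegular`
/ `isSMulRegular_of_torsionFree` convert to and from `IsSMulRegular (A ⧸ I) ϖ`):
* `mem_mul_of_mem_of_mem_span_singleton` — elementwise: `x ∈ I`, `x ∈ (ϖ)` ⇒ `x ∈ (ϖ)·I`;
* `inf_span_singleton_eq_mul_of_torsionFree` — `I ⊓ (ϖ) = (ϖ)·I`;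
* `ker_mkQ_comp_subtype_eq_smul_top` — the kernel of `I ↪ A ↠ A/(ϖ)` is `(ϖ)·I` (as the submodule `(ϖ) • ⊤` of `↥I`);
* `injective_liftQ_of_torsionFree` — hence the induced map `I/(ϖ)I → A/(ϖ)` is INJECTIVE.
[cite: StacksProject, Tag 00HI] [folklore]
-/

set_option linter.dupNamespace false

namespace Summit.ResolutionOfSingularities.ResolutionOfSingularities.Cruxes.EquisingularLiftNat.F102

variable {A : Type*} [CommRing A] (I : Ideal A) (ϖ : A)

/-- The elementwise «no `ϖ`-torsion in `A/I`» hypothesis from `IsSMulRegular (A ⧸ I) ϖ`. [folklore] -/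
theorem torsionFree_of_isSMulRegular (h : IsSMulRegular (A ⧸ I) ϖ) : ∀ a : A, ϖ * a ∈ I → a ∈ I := by
  intro a ha
  have h1 : ϖ • (Ideal.Quotient.mk I a) = ϖ • (0 : A ⧸ I) := by
    rw [smul_zero, Algebra.smul_def, Ideal.Quotient.algebraMap_eq, ← map_mul, Ideal.Quotient.eq_zero_iff_mem]
    exact ha
  exact Ideal.Quotient.eq_zero_iff_mem.mp (h h1)

/-- Conversely the elementwise hypothesis gives `IsSMulRegular (A ⧸ I) ϖ`. [folklore] -/
theorem isSMulRegular_of_torsionFree (htf : ∀ a : A, ϖ * a ∈ I → a ∈ I) : IsSMulRegular (A ⧸ I) ϖ := by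
  intro x y hxy
  obtain ⟨a, rfl⟩ := Ideal.Quotient.mk_surjective x
  obtain ⟨b, rfl⟩ := Ideal.Quotient.mk_surjective y
  have hxy' : Ideal.Quotient.mk I (ϖ * a) = Ideal.Quotient.mk I (ϖ * b) := by
    have h := hxy
    simp only [Algebra.smul_def, Ideal.Quotient.algebraMap_eq, ← map_mul] at h
    exact h
  rw [Ideal.Quotient.eq] at hxy' ⊢
  exact htf _ (by rw [mul_sub]; exact hxy')

/-- **Elementwise transversality**: `x ∈ I ∩ (ϖ)` lies in `(ϖ)·I` when `A/I` has no `ϖ`-torsion. [folklore] -/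
theorem mem_mul_of_mem_of_mem_span_singleton (htf : ∀ a : A, ϖ * a ∈ I → a ∈ I) {x : A} (hxI : x ∈ I)
    (hxϖ : x ∈ Ideal.span ({ϖ} : Set A)) : x ∈ Ideal.span ({ϖ} : Set A) * I := by
  obtain ⟨a, rfl⟩ := Ideal.mem_span_singleton'.mp hxϖ
  have ha : a ∈ I := htf a (by rw [mul_comm]; exact hxI)
  have h := Ideal.mul_mem_mul ha (Ideal.mem_span_singleton_self ϖ)
  rwa [mul_comm I (Ideal.span {ϖ})] at h

/-- **`I ∩ (ϖ) = (ϖ)·I`** when `A/I` has no `ϖ`-torsion (the special fibre meets `V(I)` transversally). [cite: StacksProject, Tag 00HI]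
[folklore] -/
theorem inf_span_singleton_eq_mul_of_torsionFree (htf : ∀ a : A, ϖ * a ∈ I → a ∈ I) :
    I ⊓ Ideal.span ({ϖ} : Set A) = Ideal.span ({ϖ} : Set A) * I := by
  refine le_antisymm (fun x hx => mem_mul_of_mem_of_mem_span_singleton I ϖ htf hx.1 hx.2) ?_
  exact Ideal.mul_le_inf.trans (le_of_eq (inf_comm _ _))

/-- **The kernel of `I ↪ A ↠ A/(ϖ)` is `(ϖ)·I`** (as the submodule `(ϖ) • ⊤` of `↥I`), when `A/I` has no `ϖ`-torsion. [folklore] -/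
theorem ker_mkQ_comp_subtype_eq_smul_top (htf : ∀ a : A, ϖ * a ∈ I → a ∈ I) :
    LinearMap.ker ((Submodule.mkQ (Ideal.span ({ϖ} : Set A))).comp (Submodule.subtype I)) =
      Ideal.span ({ϖ} : Set A) • (⊤ : Submodule A I) := by
  ext x
  have h1 : x ∈ LinearMap.ker ((Submodule.mkQ (Ideal.span ({ϖ} : Set A))).comp (Submodule.subtype I)) ↔
      (x : A) ∈ Ideal.span ({ϖ} : Set A) := by
    rw [LinearMap.mem_ker, LinearMap.comp_apply, Submodule.mkQ_apply, Submodule.Quotient.mk_eq_zero]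
    rfl
  have h2 : x ∈ Ideal.span ({ϖ} : Set A) • (⊤ : Submodule A I) ↔ (x : A) ∈ Ideal.span ({ϖ} : Set A) * I := by
    rw [Submodule.mem_smul_top_iff]
    rfl
  rw [h1, h2]
  exact ⟨fun hx => mem_mul_of_mem_of_mem_span_singleton I ϖ htf x.2 hx, fun hx => Ideal.mul_le_right hx⟩

/-- **`I/(ϖ)I → A/(ϖ)` is injective** when `A/I` has no `ϖ`-torsion: the map induced on `↥I ⧸ (ϖ) • ⊤` by `I ↪ A ↠ A/(ϖ)`.
[cite: StacksProject, Tag 00HI] [folklore] -/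
theorem injective_liftQ_of_torsionFree (htf : ∀ a : A, ϖ * a ∈ I → a ∈ I)
    (hle : Ideal.span ({ϖ} : Set A) • (⊤ : Submodule A I) ≤
      LinearMap.ker ((Submodule.mkQ (Ideal.span ({ϖ} : Set A))).comp (Submodule.subtype I))) :
    Function.Injective
      ((Ideal.span ({ϖ} : Set A) • (⊤ : Submodule A I)).liftQ
        ((Submodule.mkQ (Ideal.span ({ϖ} : Set A))).comp (Submodule.subtype I)) hle) := by
  rw [← LinearMap.ker_eq_bot]
  exact Submodule.ker_liftQ_eq_bot _ _ _ (le_of_eq (ker_mkQ_comp_subtype_eq_smul_top I ϖ htf))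

/-- The hypothesis `hle` of `injective_liftQ_of_torsionFree` always holds (`(ϖ)·I` dies in `A/(ϖ)`), so the lift exists unconditionally.
[folklore] -/
theorem smul_top_le_ker_mkQ_comp_subtype :
    Ideal.span ({ϖ} : Set A) • (⊤ : Submodule A I) ≤
      LinearMap.ker ((Submodule.mkQ (Ideal.span ({ϖ} : Set A))).comp (Submodule.subtype I)) := by
  intro x hx
  rw [LinearMap.mem_ker, LinearMap.comp_apply, Submodule.mkQ_apply, Submodule.Quotient.mk_eq_zero]
  have h2 : (x : A) ∈ Ideal.span ({ϖ} : Set A) * I := by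
    have h := (Submodule.mem_smul_top_iff (Ideal.span ({ϖ} : Set A)) I x).mp hx
    exact h
  exact Ideal.mul_le_right h2

end Summit.ResolutionOfSingularities.ResolutionOfSingularities.Cruxes.EquisingularLiftNat.F102
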